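import Literature.MathematicalPhysics.QuantumFieldTheory.Balaban1983to89.B2Prop31MinimizerRegions

/-!
# `Balaban1983to89.B2Prop31MinimizerRegionsNonzero` — [Balaban1982Higgs2] Proposition 3.1 p. 589 / Lemma 2.3 p. 571: NON-VACUITY WITH A
NON-ZERO FIELD of the constructed-regions family `B2Prop31MinimizerRegions.RegionsData` (p23 g13, p319405): for every torus with a fine
enough lattice, EVERY large-field datum `bad` and every small constant block-field value `v ≠ 0`, the `K = 1` datum `regionsDataW` is
restricted AND its field `Ã^ε` is `≠ 0` over `Λ₂^{(0)}` — Lemma 2.3 (2.59) with variation modulus `q = 0` at the cut-off radius (c) of GAPS.md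
G-B2-12, on the printed regions

statement-level skeleton of published theorems with citation tags; proofs where landed; nothing here is a claim about the Yang–Mills mass gap

CITATION HEADER.  T. Bałaban, *(Higgs)₂,₃ quantum fields in a finite volume. II. An upper bound*, Commun. Math. Phys. **86** (1982) 555–594
[Balaban1982Higgs2] (PDF held `paper:balaban1982-cmp86-higgs23-ii`, journal page = PDF page + 554; pp. 558, 566, 571, 583, 589 on the ×2 renders
`run/shared/lean/pub/pub-balaban/b2b-balaban-ref1/pages/1982-cmp86-higgs23-II/…`); part I [Balaban1982Higgs1] (2.15) p. 609.  Cell `lit-balaban`,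
Phase-2 proof seat **p23** gen 13 (unit `lit-balaban-p23-g13`; TAKING line HOME/STATUS.md 2026-08-22T04:49:42Z).  SKELETON rows **B2.Prop3.1**,
**B2.Lem2.3** (owner r02) — CELLS ONLY, no head claims; closes HONEST SCOPE (v) of `B2Prop31MinimizerRegions` (the field of the `K = 1` datum was
not shown `≠ 0` there).  USED BY NAME, NOTHING RESTATED: p23 g13 `B2Prop31MinimizerRegions.{RegionsData, RegionsData.toRMultiMR, regionsDataW,
regionsDataW_restrictedM, radC, exp_neg_delta_radC_le, six_le_radC, towerRad}` (p319405), p23 g11/g12 `B2Prop31MinimizerFamily.{Lemma23Bounds,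
exists_lemma23Bounds}`, `B2Prop31MinimizerWitness.{kappaW, kappaW_nonneg, thetaW, thetaW_one, nested_thetaW}`, `B2Eq32FieldRegularity.field32_eq_top`,
r14 `B2Lemma23HiggsLattice.cutMin`, b05 `B1.ainf_lt_aSeq`, the typer's `towerRegion` / p15's `prime`.

THE ARGUMENT (= gen 12's `B2Prop31MinimizerWitness` §2 at the radius (c) and over the regions).  Lemma 2.3 (2.61)–(2.63) p. 571 for a CONSTANT
block field `A₁ ≡ v`: the first term of (2.61) vanishes (`A(y′) − A(y) = 0`), the second is `≤ C₂e^{−δρ₁/2}‖v‖ ≤ C₂·Lε·‖v‖` (Prop. 2.2 decay beyond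
the plateau `½ρ₁`; `e^{−δρ₁/2} ≤ Lε` for `R ≥ (L/3)(2/δ + 2M + 2)`, `B2Prop31MinimizerRegions.exp_neg_delta_radC_le`), the third is (2.63)'s
`μ₀²s²/(a₁ + μ₀²s²)·‖v‖ ≤ (μ₀²/a_∞)·s·‖v‖`; so `‖A^{(1),ε}(x) − v‖ ≤ κ·Lε·‖v‖ < ‖v‖` for `κ·Lε < 1`, `κ = C₂ + μ₀²/a_∞`, at every fine `x` over
`Λ₂^{(0)}` — and `Ã^ε = A^{(1),ε}` since `θ₁ ≡ 1` ((3.2) with one step).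

WHAT THIS MODULE PROVES (kernel-checked, 0 `sorry`, standard axioms; THEOREMS ONLY).
 §1 `norm_cutMin_const_sub_le_rad` (Lemma 2.3 (2.59) for a constant block field, any level `1 ≤ k ≤ K`, any radius `ρ ≥ 0` with `e^{−δρ/2} ≤ Lᵏε`,
    regions `Λ₂ ⊆ Λ₁` with the `nbhd` property, conclusion over `Λ₂`), `norm_cutMin_const_sub_lt_rad` (`< ‖v‖` for `κ·Lᵏε < 1`, `v ≠ 0`).
 §2 `regionsDataW_field_apply` (`Ã^ε(⟨x, μ⟩) = A^{(1),ε}(x)_μ` for the datum), **`regionsDataW_field_ne_zero`** (field `≠ 0` whenever some fine point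
    lies over `(Λ₂^{(0)})′`, `v ≠ 0`, `κ·Lε < 1`, `R ≥ (L/3)(2/δ + 2M + 2)` and `≥ (L/3)(2M + 8)`), **`exists_regionsData_restricted_field_ne_zero`**
    (packaged: `∃ R₁ s₁ > 0 ∀ Q (Q.d = d, Q.L = L, Q.a = a, Q.R ≥ R₁, Q.r ≥ 1) ∀ m² ∀ tori (P.d = d, P.L = L, P.M = M, P.K ≥ 1, Lε ≤ s₁) ∀ bad ∀ v
    (‖v‖ ≤ thrA(Lε), v ≠ 0) ∀ x over (Λ₂^{(0)})′: ∃ D : RegionsData Q Γ M m², D.P = P ∧ D.K = 1 ∧ D.toRMultiMR.restrictedM ∧ D.toRMultiMR.field ≠ 0`,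
    witness `regionsDataW … bad v`).
HONEST SCOPE.  (i) One step (`K = 1`); the multi-step pattern of gen 12's `B2Prop31MinimizerWitness2` is unchanged by the regions.  (ii) The
hypothesis *"some fine point over `(Λ₂^{(0)})′`"* is genuine: with enough large-field points `Λ₂^{(0)}` can be empty, and then every field of the
family restricted to it is unconstrained — nothing to show.  (iii) Constants through r14's `(δ, C₁, C₂)`; zero external field; torus sub-family;
`d ≥ 1` here (the Prop. 3.1 theorems need `d = 2, 3`).  No row head changes (owner r02).  Nothing here is summit progress.
-/

noncomputable section

open Finset Real
open scoped BigOperators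

namespace Literature.MathematicalPhysics.QuantumFieldTheory.Balaban1983to89.B2Prop31MinimizerRegionsNonzero

open Literature.MathematicalPhysics.QuantumFieldTheory.Balaban1983to89.HiggsLattice
open Literature.MathematicalPhysics.QuantumFieldTheory.Balaban1983to89.HiggsAveraging
open Literature.MathematicalPhysics.QuantumFieldTheory.Balaban1983to89.B2Eq32FieldRegularity
open Literature.MathematicalPhysics.QuantumFieldTheory.Balaban1983to89.B2Prop31Thresholds
open Literature.MathematicalPhysics.QuantumFieldTheory.Balaban1983to89.B2Prop31ZeroFieldConcrete (mesh_le_mesh)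
open Literature.MathematicalPhysics.QuantumFieldTheory.Balaban1983to89.B3MultiscaleFields (toSite ofSite zeroCharge toSite_ofSite)
open Literature.MathematicalPhysics.QuantumFieldTheory.Balaban1983to89.B2Lemma23HiggsLattice (cutMin)
open Literature.MathematicalPhysics.QuantumFieldTheory.Balaban1983to89.B1Eq211ZeroFieldTorus (Shape)
open Literature.MathematicalPhysics.QuantumFieldTheory.Balaban1983to89.B2Prop31MinimizerFamily (MinConsts Lemma23Bounds exists_lemma23Bounds)
open Literature.MathematicalPhysics.QuantumFieldTheory.Balaban1983to89.B2Prop31MinimizerWitness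
  (thetaW thetaW_one nested_thetaW kappaW kappaW_nonneg)
open Literature.MathematicalPhysics.QuantumFieldTheory.Balaban1983to89.B2Eq244Cutoff (zeta244)
open Literature.MathematicalPhysics.QuantumFieldTheory.Balaban1983to89.B2Eq243RegionsTower (towerRegion)
open Literature.MathematicalPhysics.QuantumFieldTheory.Balaban1983to89.B2Eq324NestedRegions (prime)
open Literature.MathematicalPhysics.QuantumFieldTheory.Balaban1983to89.B2Prop31MinimizerRegions
  (radC exp_neg_delta_radC_le six_le_radC RegionsData regionsDataW regionsDataW_restrictedM towerRad L2Of)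

/-! ## §1 Lemma 2.3 (2.59) for a constant block field, general radius, over regions -/

section ConstField

/-- **LEMMA 2.3 (2.59) FOR A CONSTANT BLOCK FIELD AT A GENERAL CUT-OFF RADIUS, OVER REGIONS** (variation modulus `q = 0`): on a torus of the
sub-family with `P.d = d`, `P.L = L`, level `1 ≤ k ≤ K` with `Lᵏε ≤ ε₀`, given Lemma-2.3 constants `(δ, C₁, C₂)` (gen 11's `Lemma23Bounds`), a
radius `ρ ≥ 0` with `e^{−δρ/2} ≤ Lᵏε`, a cut-off with the four (2.44) clauses at `ρ`, and regions `Λ₂ ⊆ Λ₁` with the `nbhd` property: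
`‖A^{(k),ε}(x) − v‖ ≤ (C₂·Lᵏε + μ₀²(Lᵏε)²/(a_k + μ₀²(Lᵏε)²))·‖v‖` at every fine `x` over `Λ₂`.
[cite: Balaban1982Higgs2, Lemma 2.3 (2.59) p.571, (2.62)–(2.63) p.571, (2.44) p.566] -/
theorem norm_cutMin_const_sub_le_rad {d L : ℕ} {a μ0sq ε₀ δ C₁ C₂ : ℝ}
    (pkg : Lemma23Bounds d L a μ0sq ε₀ δ C₁ C₂) (hC₂ : 0 ≤ C₂)
    {P : HiggsLattice.Params} (S : Shape P) (hPd : P.d = d) (hPL : P.L = L) {k : ℕ} (hk1 : 1 ≤ k) (hk : k ≤ P.K)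
    (hsε : P.mesh k ≤ ε₀) {ρ : ℝ} (hρ0 : 0 ≤ ρ) (hE : Real.exp (-(δ * (ρ / 2))) ≤ P.mesh k)
    (ζ : HiggsLattice.Site P 0 → HiggsLattice.Site P k → ℝ)
    (habs : ∀ x y', |ζ x y'| ≤ 1)
    (hsupp : ∀ x y', ζ x y' ≠ 0 → (HiggsLattice.Site.tdist (blockIter k x) y' : ℝ) ≤ ρ)
    (hone : ∀ x y', (HiggsLattice.Site.tdist (blockIter k x) y' : ℝ) ≤ ρ / 2 → ζ x y' = 1)
    (hlip : ∀ (x : HiggsLattice.Site P 0) (ν : Fin P.d) (y' : HiggsLattice.Site P k),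
      |ζ (x.shift ν) y' - ζ x y'| ≤ ((P.L : ℝ) ^ k)⁻¹)
    (Λ₁ Λ₂ : Finset (HiggsLattice.Site P k)) (hsub : Λ₂ ⊆ Λ₁)
    (nbhd : ∀ x y', blockIter k x ∈ Λ₂ → (HiggsLattice.Site.tdist (blockIter k x) y' : ℝ) ≤ ρ + 1 → y' ∈ Λ₁)
    (v : EuclideanSpace ℝ (Fin P.d)) (x : HiggsLattice.Site P 0) (hx : blockIter k x ∈ Λ₂) :
    ‖cutMin (zeroCharge P.d) μ0sq a k ζ (fun _ => v) x - v‖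
      ≤ (C₂ * P.mesh k + μ0sq * P.mesh k ^ 2 / (B1.aSeq a P.L k + μ0sq * P.mesh k ^ 2)) * ‖v‖ := by
  subst hPd hPL
  have hρ₁ : 0 ≤ ρ / 2 := by linarith
  obtain ⟨h59, -⟩ := pkg P S rfl rfl (zeroCharge P.d) hk1 hk hsε ζ ρ (ρ / 2) hρ₁ habs hsupp hone hlip
    Λ₁ Λ₂ hsub nbhd (fun _ => v) ‖v‖ 0 0 0 le_rfl le_rfl le_rfl (fun y' _ => le_rfl) (fun y _ y' _ => by simp) x hx
  have hv : 0 ≤ ‖v‖ := norm_nonneg v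
  calc ‖cutMin (zeroCharge P.d) μ0sq a k ζ (fun _ => v) x - v‖
      ≤ C₁ * (0 + 0) * 0 + C₂ * Real.exp (-(δ * (ρ / 2))) * ‖v‖
          + μ0sq * P.mesh k ^ 2 / (B1.aSeq a P.L k + μ0sq * P.mesh k ^ 2) * ‖v‖ := h59
    _ = C₂ * Real.exp (-(δ * (ρ / 2))) * ‖v‖
          + μ0sq * P.mesh k ^ 2 / (B1.aSeq a P.L k + μ0sq * P.mesh k ^ 2) * ‖v‖ := by ring
    _ ≤ C₂ * P.mesh k * ‖v‖ + μ0sq * P.mesh k ^ 2 / (B1.aSeq a P.L k + μ0sq * P.mesh k ^ 2) * ‖v‖ := by gcongr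
    _ = (C₂ * P.mesh k + μ0sq * P.mesh k ^ 2 / (B1.aSeq a P.L k + μ0sq * P.mesh k ^ 2)) * ‖v‖ := by ring

/-- **`‖A^{(k),ε}(x) − v‖ < ‖v‖` (hence `A^{(k),ε}(x) ≠ 0`) for `v ≠ 0` and `κ·Lᵏε < 1`**, `κ = C₂ + μ₀²/a_∞` (gen 12's `kappaW`; `a_k > a_∞ =
a(1 − L⁻²)`, `Lᵏε ≤ 1`), under the hypotheses of `norm_cutMin_const_sub_le_rad`. [cite: Balaban1982Higgs2, Lemma 2.3 (2.59) p.571, (3.3) p.583]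
[cite: Balaban1982Higgs1, (2.15) p.609] -/
theorem norm_cutMin_const_sub_lt_rad {d L : ℕ} {a μ0sq ε₀ δ C₁ C₂ : ℝ} (ha : 0 < a) (hμ : 0 < μ0sq)
    (pkg : Lemma23Bounds d L a μ0sq ε₀ δ C₁ C₂) (hC₂ : 0 ≤ C₂)
    {P : HiggsLattice.Params} (S : Shape P) (hPd : P.d = d) (hPL : P.L = L) {k : ℕ} (hk1 : 1 ≤ k) (hk : k ≤ P.K)
    (hsε : P.mesh k ≤ ε₀) (hs1 : P.mesh k ≤ 1) {ρ : ℝ} (hρ0 : 0 ≤ ρ) (hE : Real.exp (-(δ * (ρ / 2))) ≤ P.mesh k)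
    (ζ : HiggsLattice.Site P 0 → HiggsLattice.Site P k → ℝ)
    (habs : ∀ x y', |ζ x y'| ≤ 1)
    (hsupp : ∀ x y', ζ x y' ≠ 0 → (HiggsLattice.Site.tdist (blockIter k x) y' : ℝ) ≤ ρ)
    (hone : ∀ x y', (HiggsLattice.Site.tdist (blockIter k x) y' : ℝ) ≤ ρ / 2 → ζ x y' = 1)
    (hlip : ∀ (x : HiggsLattice.Site P 0) (ν : Fin P.d) (y' : HiggsLattice.Site P k),
      |ζ (x.shift ν) y' - ζ x y'| ≤ ((P.L : ℝ) ^ k)⁻¹)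
    (Λ₁ Λ₂ : Finset (HiggsLattice.Site P k)) (hsub : Λ₂ ⊆ Λ₁)
    (nbhd : ∀ x y', blockIter k x ∈ Λ₂ → (HiggsLattice.Site.tdist (blockIter k x) y' : ℝ) ≤ ρ + 1 → y' ∈ Λ₁)
    (hsmall : kappaW a L μ0sq C₂ * P.mesh k < 1) {v : EuclideanSpace ℝ (Fin P.d)} (hv : v ≠ 0)
    (x : HiggsLattice.Site P 0) (hx : blockIter k x ∈ Λ₂) :
    ‖cutMin (zeroCharge P.d) μ0sq a k ζ (fun _ => v) x - v‖ < ‖v‖ := by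
  have h := norm_cutMin_const_sub_le_rad pkg hC₂ S hPd hPL hk1 hk hsε hρ0 hE ζ habs hsupp hone hlip Λ₁ Λ₂ hsub nbhd v x hx
  subst hPL
  have hLr : (1 : ℝ) < P.L := by exact_mod_cast S.hL.2
  set s : ℝ := P.mesh k with hs_def
  have hs : 0 < s := P.mesh_pos k
  have hainf : 0 < a * (1 - ((P.L : ℝ) ^ 2)⁻¹) := by
    have hL2 : 1 < (P.L : ℝ) ^ 2 := by nlinarith
    have : ((P.L : ℝ) ^ 2)⁻¹ < 1 := inv_lt_one_of_one_lt₀ hL2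
    exact mul_pos ha (by linarith)
  have hak : a * (1 - ((P.L : ℝ) ^ 2)⁻¹) < B1.aSeq a P.L k := B1.ainf_lt_aSeq ha hLr k hk1
  have hfrac : μ0sq * s ^ 2 / (B1.aSeq a P.L k + μ0sq * s ^ 2) ≤ μ0sq / (a * (1 - ((P.L : ℝ) ^ 2)⁻¹)) * s := by
    have hden : a * (1 - ((P.L : ℝ) ^ 2)⁻¹) ≤ B1.aSeq a P.L k + μ0sq * s ^ 2 := by nlinarith [sq_nonneg s]
    calc μ0sq * s ^ 2 / (B1.aSeq a P.L k + μ0sq * s ^ 2)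
        ≤ μ0sq * s ^ 2 / (a * (1 - ((P.L : ℝ) ^ 2)⁻¹)) := div_le_div_of_nonneg_left (by positivity) hainf hden
      _ = μ0sq / (a * (1 - ((P.L : ℝ) ^ 2)⁻¹)) * (s * s) := by rw [sq]; ring
      _ ≤ μ0sq / (a * (1 - ((P.L : ℝ) ^ 2)⁻¹)) * (s * 1) := by
          apply mul_le_mul_of_nonneg_left _ (div_nonneg hμ.le hainf.le)
          exact mul_le_mul_of_nonneg_left hs1 hs.le
      _ = μ0sq / (a * (1 - ((P.L : ℝ) ^ 2)⁻¹)) * s := by rw [mul_one]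
  have hrate : C₂ * s + μ0sq * s ^ 2 / (B1.aSeq a P.L k + μ0sq * s ^ 2) ≤ kappaW a P.L μ0sq C₂ * s := by
    unfold kappaW
    rw [add_mul]
    linarith
  have hvpos : 0 < ‖v‖ := norm_pos_iff.mpr hv
  calc ‖cutMin (zeroCharge P.d) μ0sq a k ζ (fun _ => v) x - v‖
      ≤ (C₂ * s + μ0sq * s ^ 2 / (B1.aSeq a P.L k + μ0sq * s ^ 2)) * ‖v‖ := h
    _ ≤ kappaW a P.L μ0sq C₂ * s * ‖v‖ := mul_le_mul_of_nonneg_right hrate hvpos.le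
    _ < 1 * ‖v‖ := mul_lt_mul_of_pos_right hsmall hvpos
    _ = ‖v‖ := one_mul _

end ConstField

/-! ## §2 The field of the `K = 1` datum over `Λ₂^{(0)}` is not zero -/

section NonZero

variable {Q : B2.Params} {Γ : MinConsts} {M : ℕ} {m2 : ℝ}

variable (hΓ : Γ.Valid) (hR8 : (Q.L : ℝ) / 3 * (2 * (M : ℝ) + 8) ≤ Q.R) (hr : 1 ≤ Q.r) (P : HiggsLattice.Params) (S : Shape P)
  (hPL : P.L = Q.L) (hPd : P.d = Q.d) (hPM : P.M = M) (hK1 : 1 ≤ P.K) (hε₀ : P.mesh 1 ≤ Γ.ε₀)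
  (bad : (j : ℕ) → Set (HiggsLattice.Site P j)) (v : EuclideanSpace ℝ (Fin P.d))

/-- **The field of the datum IS its (3.3) minimizer at the radius (c)**: `Ã^ε(⟨x, μ⟩) = A^{(1),ε}(x)_μ = (a₁(Lε)^{−2}ζ^{(1)}G^ε_1Q*_1v)(x)_μ` with
`ζ^{(1)} = zeta244 1 ρ₁` (`θ₁ ≡ 1`, so (3.2) has one term: `field32_eq_top`). [cite: Balaban1982Higgs2, (3.2)–(3.3) p.583] -/
theorem regionsDataW_field_apply (b : HiggsLattice.PBond P 0) :
    (regionsDataW (m2 := m2) hΓ hR8 hr P S hPL hPd hPM hK1 hε₀ bad v).toRMultiMR.field b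
      = cutMin (zeroCharge P.d) Γ.μ0sq Q.a 1 (zeta244 P 1 (radC Q.R Q.r P 1)) (fun _ => v) b.src b.dir := by
  show field32 (thetaW P) 0 (regionsDataW (m2 := m2) hΓ hR8 hr P S hPL hPd hPM hK1 hε₀ bad v).toRMultiMR.A 1 b = _
  rw [field32_eq_top (thetaW P) 0 _ nested_thetaW le_rfl b (thetaW_one _)]
  show ofSite (cutMin (zeroCharge P.d) Γ.μ0sq Q.a 1 (zeta244 P 1 (radC Q.R Q.r P 1))
    (toSite (ofSite fun _ : HiggsLattice.Site P 1 => v))) b = _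
  rw [toSite_ofSite]
  rfl

/-- **THE FIELD OF THE DATUM IS NOT ZERO** whenever some fine point `x` lies over `(Λ₂^{(0)})′` (the region where Lemma 2.3 concludes), `v ≠ 0`,
`κ·Lε < 1`, and `R ≥ (L/3)(2/δ + 2M + 2)` (the tail `e^{−δρ₁/2} ≤ Lε`) — with gen 11's Lemma-2.3 constants `(δ, C₁, C₂)` for `(Q.d, Q.L, Q.a, μ₀², ε₀)`:
`‖A^{(1),ε}(x) − v‖ < ‖v‖` by §1 fed with the CONSTRUCTED instance's own `ζ`-clauses, `L2_sub` and `nbhd`.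
[cite: Balaban1982Higgs2, Prop. 3.1 p.589, (3.2)–(3.3) p.583, Lemma 2.3 p.571, (2.8) p.558] -/
theorem regionsDataW_field_ne_zero (hQa : 0 < Q.a) {δ C₁ C₂ : ℝ} (pkg : Lemma23Bounds Q.d Q.L Q.a Γ.μ0sq Γ.ε₀ δ C₁ C₂) (hδ : 0 < δ)
    (hC₂ : 0 ≤ C₂) (hRδ : (Q.L : ℝ) / 3 * (2 / δ + 2 * (M : ℝ) + 2) ≤ Q.R) (hsmall : kappaW Q.a Q.L Γ.μ0sq C₂ * P.mesh 1 < 1)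
    (hv : v ≠ 0) {x : HiggsLattice.Site P 0} (hx : blockIter 1 x ∈ prime (towerRegion bad (towerRad Q P) 0 2)) :
    (regionsDataW (m2 := m2) hΓ hR8 hr P S hPL hPd hPM hK1 hε₀ bad v).toRMultiMR.field ≠ 0 := by
  intro h0
  set D := regionsDataW (m2 := m2) hΓ hR8 hr P S hPL hPd hPM hK1 hε₀ bad v with hD
  have hs1 : P.mesh 1 ≤ 1 := hε₀.trans hΓ.ε₀_le_one
  have hRδ' : (P.L : ℝ) / 3 * (2 / δ + 2 * (P.M : ℝ) + 2) ≤ Q.R := by rw [hPL, hPM]; exact hRδ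
  have hR8' : (P.L : ℝ) / 3 * (2 * (P.M : ℝ) + 8) ≤ Q.R := by rw [hPL, hPM]; exact hR8
  have hE : Real.exp (-(δ * (radC Q.R Q.r P 1 / 2))) ≤ P.mesh 1 := exp_neg_delta_radC_le le_rfl hs1 hδ hRδ' hr
  have hρ0 : 0 ≤ radC Q.R Q.r P 1 := by
    have h6 : 6 ≤ radC Q.R Q.r P 1 := six_le_radC le_rfl hs1 hR8' hr
    linarith
  have hx' : blockIter 1 x ∈ D.toRMultiMR.L2 1 := hx
  have hlt := norm_cutMin_const_sub_lt_rad hQa hΓ.μ0sq_pos pkg hC₂ S hPd hPL (k := 1) le_rfl hK1 hε₀ hs1 hρ0 hE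
    (zeta244 P 1 (radC Q.R Q.r P 1)) (D.toRMultiMR.ζ_abs 1 le_rfl le_rfl) (D.toRMultiMR.ζ_supp 1 le_rfl le_rfl)
    (D.toRMultiMR.ζ_one 1 le_rfl le_rfl) (D.toRMultiMR.ζ_lip 1 le_rfl le_rfl) (D.toRMultiMR.L1 1) (D.toRMultiMR.L2 1)
    (D.toRMultiMR.L2_sub 1) (D.toRMultiMR.nbhd 1 le_rfl le_rfl) hsmall hv x hx'
  have hne : cutMin (zeroCharge P.d) Γ.μ0sq Q.a 1 (zeta244 P 1 (radC Q.R Q.r P 1)) (fun _ => v) x ≠ 0 := by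
    intro hz
    rw [hz, zero_sub, norm_neg] at hlt
    exact lt_irrefl _ hlt
  apply hne
  ext μ
  have hb := congrFun h0 ⟨x, μ⟩
  rw [regionsDataW_field_apply] at hb
  rw [hb]
  rfl

end NonZero

/-! ## §3 Packaged: every torus with a fine enough lattice, every large-field datum -/

section Packaged

/-- **NON-VACUITY OF THE CONSTRUCTED-REGIONS FAMILY AT `K = 1` WITH A NON-ZERO FIELD.**  For `d ≥ 1`, odd `L > 1`, a large-block factor `M`, `a > 0`
and a valid constants record `Γ` there are `R₁ > 0` and `0 < s₁ ≤ ε₀` (through r14's Lemma-2.3 constants) such that: for every `Q` with `Q.d = d`,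
`Q.L = L`, `Q.a = a`, `Q.R ≥ R₁`, `Q.r ≥ 1`, every `m²`, every torus `P` of the sub-family with `P.d = d`, `P.L = L`, `P.M = M`, `P.K ≥ 1`, `Lε ≤ s₁`,
EVERY large-field datum `bad`, every constant block-field value `v ≠ 0` obeying (2.55)₂ `‖v‖ ≤ thrA(Lε)`, and every fine point `x` over
`(Λ₂^{(0)})′` (the step-1 region (2.8) built from `bad 0`), there is a datum `D : RegionsData Q Γ M m²` on `P` with one step whose constructed
instance is restricted and has field `Ã^ε ≠ 0` (witness: `regionsDataW … bad v`). [cite: Balaban1982Higgs2, Prop. 3.1 p.589, (3.3) p.583, (2.44) p.566, (2.55) p.570, Lemma 2.3 p.571, (2.8) p.558] -/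
theorem exists_regionsData_restricted_field_ne_zero (d L M : ℕ) (hd : 1 ≤ d) (hL : Odd L ∧ 1 < L) {a : ℝ} (ha : 0 < a)
    (Γ : MinConsts) (hΓ : Γ.Valid) :
    ∃ R₁ s₁ : ℝ, 0 < R₁ ∧ 0 < s₁ ∧ s₁ ≤ Γ.ε₀ ∧
      ∀ (Q : B2.Params), Q.d = d → Q.L = L → Q.a = a → R₁ ≤ Q.R → 1 ≤ Q.r → ∀ (m2 : ℝ)
        (P : HiggsLattice.Params) (_S : Shape P), P.d = d → P.L = L → P.M = M → 1 ≤ P.K → P.mesh 1 ≤ s₁ →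
        ∀ (bad : (j : ℕ) → Set (HiggsLattice.Site P j)) (v : EuclideanSpace ℝ (Fin P.d)), ‖v‖ ≤ Γ.thrA P.d (P.mesh 1) → v ≠ 0 →
        ∀ x : HiggsLattice.Site P 0, blockIter 1 x ∈ prime (towerRegion bad (towerRad Q P) 0 2) →
          ∃ D : RegionsData Q Γ M m2, D.P = P ∧ D.K = 1 ∧ D.toRMultiMR.restrictedM ∧ D.toRMultiMR.field ≠ 0 := by
  obtain ⟨δ, C₁, C₂, hδ, hC₁, hC₂, pkg⟩ := exists_lemma23Bounds d L hd hL ha hΓ.μ0sq_pos Γ.ε₀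
  set κ : ℝ := kappaW a L Γ.μ0sq C₂ with hκ
  have hκ0 : 0 ≤ κ := kappaW_nonneg ha hL.2 hΓ.μ0sq_pos.le hC₂.le
  have hLpos : (0 : ℝ) < (L : ℝ) := by exact_mod_cast (lt_trans Nat.zero_lt_one hL.2)
  refine ⟨(L : ℝ) / 3 * (2 / δ + 2 * (M : ℝ) + 8), min Γ.ε₀ (1 / (2 * (κ + 1))), by positivity,
    lt_min hΓ.ε₀_pos (by positivity), min_le_left _ _, ?_⟩
  intro Q hQd hQL hQa hR hr m2 P S hPd hPL hPM hK1 hs bad v hv hv0 x hx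
  subst hQd hQL hQa
  have hR8 : (Q.L : ℝ) / 3 * (2 * (M : ℝ) + 8) ≤ Q.R := by
    have : (Q.L : ℝ) / 3 * (2 * (M : ℝ) + 8) ≤ (Q.L : ℝ) / 3 * (2 / δ + 2 * (M : ℝ) + 8) := by
      apply mul_le_mul_of_nonneg_left _ (by positivity)
      have : 0 < 2 / δ := by positivity
      linarith
    exact this.trans hR
  have hRδ : (Q.L : ℝ) / 3 * (2 / δ + 2 * (M : ℝ) + 2) ≤ Q.R := by
    have : (Q.L : ℝ) / 3 * (2 / δ + 2 * (M : ℝ) + 2) ≤ (Q.L : ℝ) / 3 * (2 / δ + 2 * (M : ℝ) + 8) :=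
      mul_le_mul_of_nonneg_left (by linarith) (by positivity)
    exact this.trans hR
  have hε₀ : P.mesh 1 ≤ Γ.ε₀ := hs.trans (min_le_left _ _)
  have hsmall : kappaW Q.a Q.L Γ.μ0sq C₂ * P.mesh 1 < 1 := by
    rw [← hκ]
    have h1 : P.mesh 1 ≤ 1 / (2 * (κ + 1)) := hs.trans (min_le_right _ _)
    have h2 : κ * P.mesh 1 ≤ κ * (1 / (2 * (κ + 1))) := mul_le_mul_of_nonneg_left h1 hκ0
    have h3 : κ * (1 / (2 * (κ + 1))) < 1 := by
      rw [mul_one_div, div_lt_one (by positivity)]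
      linarith
    linarith
  refine ⟨regionsDataW hΓ hR8 hr P S hPL hPd hPM hK1 hε₀ bad v, rfl, rfl,
    regionsDataW_restrictedM hΓ hR8 hr P S hPL hPd hPM hK1 hε₀ bad hv, ?_⟩
  exact regionsDataW_field_ne_zero hΓ hR8 hr P S hPL hPd hPM hK1 hε₀ bad v ha pkg hδ hC₂.le hRδ hsmall hv0 hx

end Packaged

end Literature.MathematicalPhysics.QuantumFieldTheory.Balaban1983to89.B2Prop31MinimizerRegionsNonzero

end
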